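import Literature.Computability.AlgebraicComplexity.UnitTensorMomentPolytopeReduction
import HarnessLib

/-!
# `Δ(⟨4⟩) = Kron(4,4,4)` from a finite list of rays: generators of the Kronecker cone that occur in `⟨4⟩`

Topic `Computability/AlgebraicComplexity`; proofs file (theorems only, no definitions, no named
facts) of the named fact `vandenBergEtAl2025_unitTensor_four_polytope_maximal`
(`UnitTensorMomentPolytope.lean`: every partition triple occurring in a power of a tensor of format
`≤ 4×4×4` has a multiple occurring in a power of `⟨4⟩`, i.e. `Kron(4,4,4) ⊆ Δ(⟨4⟩)`). The source
establishes that inclusion by checking the VERTICES of `Kron(4,4,4)` — "`Δ(⟨4⟩)` equals `Kron₄₄₄`, as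
can be seen using the tensor scaling algorithm and knowledge of the vertices of `Kron₄₄₄`, which were
determined in [Vergne–Walter 2017]" [vandenBergChristandlLysikovNieuwboerWalterZuiddam2025, §1 after
Cor. 1.5]; "Letting `p` range over the vertices of `Δ(ℂᵃ⊗ℂᵇ⊗ℂᶜ)`, we can determine whether they also
lie in `Δ(T)`" (ibid., before "Moment polytope separations"); "If we let `p` range over the vertices
of `P` and … prove `p ∈ Δ(T)` for all `p`, we obtain `P ⊆ Δ(T)` by convexity"
[vandenBergEtAl2025ComputingMomentPolytopes, §6.2]. This file PROVES that reduction in the tree's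
(semigroup) coordinates, with BOTH computational inputs as explicit hypotheses — the route's planned
two layers `KroneckerConeGenerators` and `UnitTensorHitsGenerators`
(`Summits/MatrixMultiplication/…/Theses/IsotypicSaturation.lean`, TWO-LAYER PLAN):

* `exists_occurring_sum_smul` — **"convexity" in semigroup form**: for a cubic-format tensor `t`, if
  each weight triple `w r`, `r ∈ S`, with positive coefficient `a r` is the weight of a partition triple
  OCCURRING in a power of `t`, then so is the combination `∑_{r ∈ S} a r • w r` (`a r ∈ ℕ`, not all
  zero) — iterating the semigroup property of occurrence (`IsotypicOccurrenceSemigroup.lean`: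
  `isotypicSum₁₂₃_kroneckerPow_ne_zero_rowAdd`, scaling `…_of_parts_eq_map_mul'`) along the weights
  (`ofPartition_rowAdd`, `ofPartition_eq_smul_of_parts_eq`).
* `vandenBergEtAl2025_unitTensor_four_polytope_maximal_of_rays` — **the named fact follows from**
  (KroneckerConeGenerators) a finite family of weight triples `w r ∈ (ℤ⁴)³`, `r ∈ S`, such that every
  partition triple `λ ⊢ n`, `n > 0`, with positive Kronecker coefficient and at most `4` parts has a
  positive multiple `M·λ` whose weight is an `ℕ`-combination `∑ a r • w r` (this is what the
  Vergne–Walter vertex list of `Kron(4,4,4)` provides: `328` vertices modulo `S₃`, denominators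
  `≤ 24`, [vandenBergEtAl2025ComputingMomentPolytopes, §6.2, Table 8 / data repository]), **and**
  (UnitTensorHitsGenerators) for each `r ∈ S` an occurring partition triple of weight `w r` in some
  power `⟨4⟩^{⊗m}`, `m > 0` (the certified inclusions, ibid. §6.5; by
  `UnitTensorMomentPolytopeSymmetry.lean` one representative per `S₃`-orbit is enough once the list
  is closed up under `S₃`). Ingredients: occurrence ⇒ positive Kronecker coefficient and `≤ 4` parts
  (`IsotypicOccurrenceKronecker.lean`, Schur–Weyl vanishing), the lemma above for `t = ⟨4⟩`,
  weights determine partitions with `≤ 4` parts (`Weight.ofPartition_injOn_holds`,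
  `Weight.size_ofPartition_holds`).

Neither hypothesis is supplied here: the Vergne–Walter description of `Kron(4,4,4)` (GIT) and the
`328` certificates are the computational content of the source and are NOT in the tree (unit
`NOTES.md`, `## Census`); the named fact stays a cited hypothesis.

## References

* [vandenBergChristandlLysikovNieuwboerWalterZuiddam2025] M. van den Berg, M. Christandl, V. Lysikov,
  H. Nieuwboer, M. Walter, J. Zuiddam, *The moment polytope of matrix multiplication is not maximal*,
  arXiv:2503.22633, §1.
* [vandenBergEtAl2025ComputingMomentPolytopes] same authors, *Computing moment polytopes*,
  arXiv:2510.08336, §6.2 (inclusion verification), §6.5, Table 8.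
* [BurgisserIkenmeyer2011] P. Bürgisser, C. Ikenmeyer, arXiv:1011.1350, §3.1–3.2, Lemma 10.18–10.19
  (rational points of `Δ` have multiples in `S(w)`).
* M. Vergne, M. Walter, *Inequalities for moment cones of finite-dimensional representations*,
  J. Symplectic Geom. 15 (2017) = arXiv:1410.8144, §6.
-/

noncomputable section

open scoped BigOperators

namespace Literature.Computability.AlgebraicComplexity

open Literature.NumberTheory.DiophantineGeometry (Weight kroneckerCoeff)

/-! ## §1 Occurring weight triples of a cubic-format tensor form an `ℕ`-cone -/

section Cone

variable {d : ℕ}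

/-- **Semigroup step on weights**: if the weight triples `w` and `w'` are weights of partition
triples (with `≤ d` parts) occurring in powers of `t ∈ ℂᵈ ⊗ ℂᵈ ⊗ ℂᵈ`, so is `w + w'` — the row-wise
sum of the two triples occurs (`isotypicSum₁₂₃_kroneckerPow_ne_zero_rowAdd`) and has weight `w + w'`
(`ofPartition_rowAdd`). [cite: BurgisserIkenmeyer2011, Def. 3.1 and §10.1] -/
theorem exists_occurring_add (t : Fin d → Fin d → Fin d → ℂ) {w w' : Fin 3 → Weight (Fin d)}
    (h : ∃ (m : ℕ) (rho : Fin 3 → Nat.Partition m), 0 < m ∧ (∀ j, (rho j).parts.card ≤ d) ∧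
      (∀ j, Weight.ofPartition d (rho j) = w j) ∧
        isotypicSum₁ (rho 0) (isotypicSum₂ (rho 1) (isotypicSum₃ (rho 2) (kroneckerPow t m))) ≠ 0)
    (h' : ∃ (m : ℕ) (rho : Fin 3 → Nat.Partition m), 0 < m ∧ (∀ j, (rho j).parts.card ≤ d) ∧
      (∀ j, Weight.ofPartition d (rho j) = w' j) ∧
        isotypicSum₁ (rho 0) (isotypicSum₂ (rho 1) (isotypicSum₃ (rho 2) (kroneckerPow t m))) ≠ 0) :
    ∃ (m : ℕ) (rho : Fin 3 → Nat.Partition m), 0 < m ∧ (∀ j, (rho j).parts.card ≤ d) ∧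
      (∀ j, Weight.ofPartition d (rho j) = (w + w') j) ∧
        isotypicSum₁ (rho 0) (isotypicSum₂ (rho 1) (isotypicSum₃ (rho 2) (kroneckerPow t m))) ≠ 0 := by
  obtain ⟨m, rho, hm, hc, hw, hocc⟩ := h
  obtain ⟨m', rho', hm', hc', hw', hocc'⟩ := h'
  refine ⟨m + m', fun j => (rho j).rowAdd (rho' j), by omega, fun j => ?_, fun j => ?_, ?_⟩
  · exact (Literature.Computability.Complexity.card_parts_rowAdd_le _ _).trans (max_le (hc j) (hc' j))
  · rw [Literature.Computability.Complexity.ofPartition_rowAdd, hw j, hw' j, Pi.add_apply]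
  · exact isotypicSum₁₂₃_kroneckerPow_ne_zero_rowAdd hocc hocc'

/-- **Scaling on weights**: if `w` is the weight of an occurring triple then so is `k • w`, `k ≥ 1`
(`isotypicSum₁₂₃_kroneckerPow_ne_zero_of_parts_eq_map_mul'`, `ofPartition_eq_smul_of_parts_eq`).
[cite: BurgisserIkenmeyer2011, Lemma 10.19] -/
theorem exists_occurring_smul (t : Fin d → Fin d → Fin d → ℂ) {w : Fin 3 → Weight (Fin d)}
    (h : ∃ (m : ℕ) (rho : Fin 3 → Nat.Partition m), 0 < m ∧ (∀ j, (rho j).parts.card ≤ d) ∧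
      (∀ j, Weight.ofPartition d (rho j) = w j) ∧
        isotypicSum₁ (rho 0) (isotypicSum₂ (rho 1) (isotypicSum₃ (rho 2) (kroneckerPow t m))) ≠ 0)
    {k : ℕ} (hk : 0 < k) :
    ∃ (m : ℕ) (rho : Fin 3 → Nat.Partition m), 0 < m ∧ (∀ j, (rho j).parts.card ≤ d) ∧
      (∀ j, Weight.ofPartition d (rho j) = (k • w) j) ∧
        isotypicSum₁ (rho 0) (isotypicSum₂ (rho 1) (isotypicSum₃ (rho 2) (kroneckerPow t m))) ≠ 0 := by
  obtain ⟨m, rho, hm, hc, hw, hocc⟩ := h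
  choose mu hmu using fun j => exists_partition_parts_eq_map_mul (rho j) hk
  refine ⟨k * m, mu, Nat.mul_pos hk hm, fun j => ?_, fun j => ?_, ?_⟩
  · rw [hmu j, Multiset.card_map]; exact hc j
  · rw [ofPartition_eq_smul_of_parts_eq d (hmu j), hw j, Pi.smul_apply]
  · exact isotypicSum₁₂₃_kroneckerPow_ne_zero_of_parts_eq_map_mul' hocc hk rfl hmu

/-- **Occurring weight triples form an `ℕ`-cone** ("by convexity", [vdB+25b, §6.2], in semigroup
form): if every `w r` with `a r > 0` is the weight of a partition triple occurring in a power of `t`,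
and some `a r > 0`, then `∑_{r ∈ S} a r • w r` is the weight of an occurring triple.
[cite: vandenBergEtAl2025ComputingMomentPolytopes, §6.2] [cite: BurgisserIkenmeyer2011, Lemma 10.18–10.19] -/
theorem exists_occurring_sum_smul (t : Fin d → Fin d → Fin d → ℂ) {R : Type*} (S : Finset R)
    (w : R → Fin 3 → Weight (Fin d)) (a : R → ℕ)
    (h : ∀ r ∈ S, 0 < a r → ∃ (m : ℕ) (rho : Fin 3 → Nat.Partition m), 0 < m ∧
      (∀ j, (rho j).parts.card ≤ d) ∧ (∀ j, Weight.ofPartition d (rho j) = w r j) ∧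
        isotypicSum₁ (rho 0) (isotypicSum₂ (rho 1) (isotypicSum₃ (rho 2) (kroneckerPow t m))) ≠ 0)
    (hpos : ∃ r ∈ S, 0 < a r) :
    ∃ (m : ℕ) (rho : Fin 3 → Nat.Partition m), 0 < m ∧ (∀ j, (rho j).parts.card ≤ d) ∧
      (∀ j, Weight.ofPartition d (rho j) = (∑ r ∈ S, a r • w r) j) ∧
        isotypicSum₁ (rho 0) (isotypicSum₂ (rho 1) (isotypicSum₃ (rho 2) (kroneckerPow t m))) ≠ 0 := by
  classical
  -- strengthen: either all coefficients on `S` vanish, or the partial combination occurs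
  suffices H : (∀ r ∈ S, a r = 0) ∨ ∃ (m : ℕ) (rho : Fin 3 → Nat.Partition m), 0 < m ∧
      (∀ j, (rho j).parts.card ≤ d) ∧ (∀ j, Weight.ofPartition d (rho j) = (∑ r ∈ S, a r • w r) j) ∧
        isotypicSum₁ (rho 0) (isotypicSum₂ (rho 1) (isotypicSum₃ (rho 2) (kroneckerPow t m))) ≠ 0 by
    rcases H with H | H
    · obtain ⟨r, hr, har⟩ := hpos
      exact absurd (H r hr) har.ne'
    · exact H
  clear hpos
  induction S using Finset.induction_on with
  | empty => exact Or.inl fun r hr => absurd hr (Finset.notMem_empty r)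
  | @insert r S hrS ih =>
    have hS : ∀ r' ∈ S, 0 < a r' → ∃ (m : ℕ) (rho : Fin 3 → Nat.Partition m), 0 < m ∧
        (∀ j, (rho j).parts.card ≤ d) ∧ (∀ j, Weight.ofPartition d (rho j) = w r' j) ∧
          isotypicSum₁ (rho 0) (isotypicSum₂ (rho 1) (isotypicSum₃ (rho 2) (kroneckerPow t m))) ≠ 0 :=
      fun r' hr' => h r' (Finset.mem_insert_of_mem hr')
    rcases ih hS with hzero | hoccS
    · by_cases har : a r = 0
      · exact Or.inl fun r' hr' => by
          rcases Finset.mem_insert.1 hr' with rfl | hr'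
          · exact har
          · exact hzero r' hr'
      · right
        have hsum : ∑ r' ∈ insert r S, a r' • w r' = a r • w r := by
          rw [Finset.sum_insert hrS, Finset.sum_eq_zero (fun r' hr' => by rw [hzero r' hr', zero_smul]),
            add_zero]
        rw [hsum]
        exact exists_occurring_smul t (h r (Finset.mem_insert_self r S) (Nat.pos_of_ne_zero har))
          (Nat.pos_of_ne_zero har)
    · right
      by_cases har : a r = 0
      · have hsum : ∑ r' ∈ insert r S, a r' • w r' = ∑ r' ∈ S, a r' • w r' := by
          rw [Finset.sum_insert hrS, har, zero_smul, zero_add]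
        rw [hsum]
        exact hoccS
      · rw [Finset.sum_insert hrS]
        exact exists_occurring_add t
          (exists_occurring_smul t (h r (Finset.mem_insert_self r S) (Nat.pos_of_ne_zero har))
            (Nat.pos_of_ne_zero har)) hoccS

end Cone

/-! ## §2 The named fact from the two computational layers -/

/-- The size of an `ℕ`-multiple of a weight. [folklore] -/
theorem size_nsmul_weight {d : ℕ} (M : ℕ) (χ : Weight (Fin d)) :
    Weight.size (M • χ) = (M : ℤ) * Weight.size χ := by
  simp only [Weight.size, Pi.smul_apply, nsmul_eq_mul, Finset.mul_sum]

/-- **`Δ(⟨4⟩) = Kron(4,4,4)` from its two computational layers.** Let `w r ∈ (ℤ⁴)³`, `r ∈ S`, be a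
finite family of weight triples (the rays of `Kron(4,4,4)` closed up under `S₃`, suitably scaled) with
(KroneckerConeGenerators) every partition triple `λ ⊢ n`, `n > 0`, of positive Kronecker coefficient
and at most `4` parts having a positive multiple `M·λ` whose weight triple is an `ℕ`-combination
`∑_{r ∈ S} a r • w r`, and
(UnitTensorHitsGenerators) every `w r` being the weight triple of a partition triple occurring in a
power `⟨4⟩^{⊗m}`, `m > 0`, of the unit tensor.
Then `vandenBergEtAl2025_unitTensor_four_polytope_maximal` holds: an occurring triple of a tensor of
format `≤ 4×4×4` has positive Kronecker coefficient and `≤ 4` parts (Schur–Weyl), its multiple `M·λ`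
has the weight of an `ℕ`-combination of occurring weights, which occurs (§1), and a partition with
`≤ 4` parts is determined by its weight. This is the printed reduction "let `p` range over the
vertices of `Kron₄₄₄` … by convexity"; the two hypotheses are the Vergne–Walter vertex list and the
certified inclusions, NOT supplied in the tree.
[cite: vandenBergChristandlLysikovNieuwboerWalterZuiddam2025, §1 after Cor. 1.5]
[cite: vandenBergEtAl2025ComputingMomentPolytopes, §6.2 and §6.5] -/
theorem vandenBergEtAl2025_unitTensor_four_polytope_maximal_of_rays {R : Type*} (S : Finset R)
    (w : R → Fin 3 → Weight (Fin 4))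
    (hgen : ∀ (n : ℕ) (lam : Fin 3 → Nat.Partition n), 0 < n →
      0 < kroneckerCoeff ℂ (lam 0) (lam 1) (lam 2) → (∀ j, (lam j).parts.card ≤ 4) →
      ∃ (M : ℕ) (a : R → ℕ), 0 < M ∧ ∀ j, M • Weight.ofPartition 4 (lam j) = (∑ r ∈ S, a r • w r) j)
    (hocc : ∀ r ∈ S, ∃ (m : ℕ) (rho : Fin 3 → Nat.Partition m), 0 < m ∧
      (∀ j, Weight.ofPartition 4 (rho j) = w r j) ∧
        isotypicSum₁ (rho 0) (isotypicSum₂ (rho 1) (isotypicSum₃ (rho 2)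
          (kroneckerPow (unitTensor ℂ 4) m))) ≠ 0) :
    vandenBergEtAl2025_unitTensor_four_polytope_maximal := by
  classical
  intro ι κ μ _ _ _ hι hκ hμ s n lam hn hocc0
  -- the hypothesis side lies in the format-4 Kronecker semigroup
  have hg := kroneckerCoeff_pos_of_isotypicSum₁₂₃_kroneckerPow_ne_zero hocc0
  obtain ⟨c₀, c₁, c₂⟩ := card_parts_le_of_isotypicSum₁₂₃_kroneckerPow_ne_zero hocc0
  have hcard : ∀ j, (lam j).parts.card ≤ 4 := by
    intro j
    fin_cases j
    · exact c₀.trans hι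
    · exact c₁.trans hκ
    · exact c₂.trans hμ
  -- layer 1: a multiple of `lam` is an ℕ-combination of the rays
  obtain ⟨M, a, hM, hMw⟩ := hgen n lam hn hg hcard
  -- occurring triples of `⟨4⟩` have `≤ 4` parts, so `hocc` feeds §1
  have hocc' : ∀ r ∈ S, 0 < a r → ∃ (m : ℕ) (rho : Fin 3 → Nat.Partition m), 0 < m ∧
      (∀ j, (rho j).parts.card ≤ 4) ∧ (∀ j, Weight.ofPartition 4 (rho j) = w r j) ∧
        isotypicSum₁ (rho 0) (isotypicSum₂ (rho 1) (isotypicSum₃ (rho 2)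
          (kroneckerPow (unitTensor ℂ 4) m))) ≠ 0 := by
    intro r hr _
    obtain ⟨m, rho, hm, hw, hρ⟩ := hocc r hr
    obtain ⟨d₀, d₁, d₂⟩ := card_parts_le_of_isotypicSum₁₂₃_kroneckerPow_ne_zero hρ
    rw [Fintype.card_fin] at d₀ d₁ d₂
    refine ⟨m, rho, hm, fun j => ?_, hw, hρ⟩
    fin_cases j
    · exact d₀
    · exact d₁
    · exact d₂
  -- some coefficient is positive: the weight of `M·lam 0` has size `M n > 0`
  have hpos : ∃ r ∈ S, 0 < a r := by
    by_contra hno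
    have hno' : ∀ r ∈ S, a r = 0 := fun r hr =>
      Nat.le_zero.1 (Nat.not_lt.1 fun h => hno ⟨r, hr, h⟩)
    have hz : (∑ r ∈ S, a r • w r) 0 = 0 := by
      rw [Finset.sum_eq_zero (fun r hr => by rw [hno' r hr, zero_smul]), Pi.zero_apply]
    have hsize := congrArg Weight.size (hMw 0)
    rw [hz, size_nsmul_weight, Weight.size_ofPartition_holds (hcard 0)] at hsize
    have h0 : Weight.size (0 : Weight (Fin 4)) = 0 := by simp [Weight.size]
    rw [h0] at hsize
    have : (0 : ℤ) < (M : ℤ) * (n : ℤ) := by positivity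
    exact this.ne' hsize
  -- layer 2 + §1: the combination occurs in a power of `⟨4⟩`
  obtain ⟨m, Lam, hm, hLc, hLw, hLocc⟩ := exists_occurring_sum_smul (unitTensor ℂ 4) S w a hocc' hpos
  -- the scaled triple `M·lam`
  choose mu hmu using fun j => exists_partition_parts_eq_map_mul (lam j) hM
  have hmuw : ∀ j, Weight.ofPartition 4 (mu j) = Weight.ofPartition 4 (Lam j) := by
    intro j
    rw [ofPartition_eq_smul_of_parts_eq 4 (hmu j), hLw j, ← hMw j]
  have hmuc : ∀ j, (mu j).parts.card ≤ 4 := fun j => by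
    rw [hmu j, Multiset.card_map]; exact hcard j
  -- degrees agree: sizes of equal weights
  have hdeg : m = M * n := by
    have e₁ := Weight.size_ofPartition_holds (N := 4) (hmuc 0)
    have e₂ := Weight.size_ofPartition_holds (N := 4) (hLc 0)
    rw [hmuw 0, e₂] at e₁
    exact_mod_cast e₁
  subst hdeg
  -- weights determine partitions with `≤ 4` parts
  have hml : ∀ j, mu j = Lam j := fun j =>
    Weight.ofPartition_injOn_holds 4 (M * n) (hmuc j) (hLc j) (hmuw j)
  refine ⟨M, mu, hM, hmu, ?_⟩
  rw [hml 0, hml 1, hml 2]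
  exact hLocc

end Literature.Computability.AlgebraicComplexity
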